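import Summits.AtomisticToContinuum.BoseEinsteinCondensation.Theses.BECStoquasticCensoring
import Literature.MathematicalPhysics.QuantumManyBody.BoseGasThermodynamicLimitRuelle
import Literature.MathematicalPhysics.QuantumManyBody.PeriodicBoseGasScattering
import Mathlib.MeasureTheory.Constructions.HaarToSphere

/-!
# Route BECStoquasticCensoring — `CellCountTails` (support item stmt-AtomisticToContinuum-14967):
reductions and normal form

Helper lemmas for the fixed-`K` cell-count tail item `CellCountTails` (they SUPPORT the item; none
of them asserts it):

* `cellCountTails_of_cellCountTailsU` — the restated fixed-`K` support IS the corollary of the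
  `K`-uniform crux `CellCountTailsU` (stmt-AtomisticToContinuum-14965): at fixed `K ≥ K₀` the cap
  `K ≤ log N` and the room condition `3ℓ ≤ L` hold for all large `N` (and where `3ℓ > L` there is no
  interior cell, so any `δ` serves). This is the planners' `cellCountTails'_of_U'` (Sketch.lean of
  route-repair #2), landed; contrapositively `¬ CellCountTails → ¬ CellCountTailsU` — the item's
  role as refutation proxy.
* `cellCountTails_body_of_toReal_scatteringLength_eq_zero` — for a potential whose scattering
  length has real part `0` (`a = 0`, i.e. `v(|·|) = 0` a.e., the free gas; or formally `a = ⊤`,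
  which finite range excludes) the body of the item holds VACUOUSLY: `ℓ = K·(ρ·0)^(-1/2) = 0`, so no
  `M` has `1 ≤ M` and `M² ≤ ρℓ³ = 0`.
* `cellCountTails_iff_pos_scatteringLength` — NORMAL FORM: `CellCountTails` is equivalent to its
  restriction to genuinely interacting potentials `0 < a < ∞`; every proof may assume, and every
  counterexample must have, `0 < scatteringLength v` (and `≠ ⊤`, automatic for finite range by
  `scatteringLength_ne_top_of_finiteRange`).
* (appended) `measure_preimage_norm`, `ae_comp_norm_of_ae_restrict_Ioi`,
  `ae_restrict_Ioi_of_ae_comp_norm` — polar coordinates: a radial shell over a Lebesgue-null set of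
  radii is Haar-null and conversely (Mathlib `measurePreserving_homeomorphUnitSphereProd`); hence
  `scatteringLength_eq_zero_of_ae_restrict_Ioi` / `scatteringLength_eq_zero_iff_ae_restrict_Ioi`
  (`a = 0 ↔ v = 0` a.e. on `(0,∞)` for the standing class) and the FREE-GAS branch of the item in the
  route's own phrasing, `cellCountTails_body_of_ae_restrict_Ioi` (vacuous, via `a = 0`).
-/

noncomputable section

namespace Summit.AtomisticToContinuum.BoseEinsteinCondensation.Theorems

open MeasureTheory ENNReal Filter Literature.MathematicalPhysics.QuantumManyBody.BoseGas
open Summit.AtomisticToContinuum.BoseEinsteinCondensation.Theses.BECStoquasticCensoring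

/-- **Fixed-`K` tails from `K`-uniform tails.** The capped, `K`-uniform crux `CellCountTailsU`
(constants `C, c₁` after `ρ`, one `N`-threshold for all `K₀ ≤ K ≤ log N` with `3ℓ ≤ L`) implies the
fixed-`K` support `CellCountTails` (same constants, `N`-threshold after `K`, no cap, no room
hypothesis): for fixed `K`, `K ≤ log N` eventually (`log N → ∞`), and if `3ℓ > L` the interior-cell
condition `ℓ ≤ x₀ₖ`, `x₀ₖ + 2ℓ ≤ L` is unsatisfiable, so `δ = 1` serves vacuously. Contrapositive:
`¬ CellCountTails → ¬ CellCountTailsU` (refutation proxy). [folklore] -/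
theorem cellCountTails_of_cellCountTailsU (hU : CellCountTailsU) : CellCountTails := by
  intro v hv
  obtain ⟨K₀, ρ₀, hρ₀, h⟩ := hU v hv
  refine ⟨K₀, ρ₀, hρ₀, fun ρ hρ hρ₁ => ?_⟩
  obtain ⟨C, c₁, hc₁, hN⟩ := h ρ hρ hρ₁
  refine ⟨C, c₁, hc₁, fun K hK => ?_⟩
  have hlog : ∀ᶠ N : ℕ in atTop, K ≤ Real.log N :=
    (Real.tendsto_log_atTop.comp tendsto_natCast_atTop_atTop).eventually_ge_atTop K
  filter_upwards [hN, hlog] with N hN' hK'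
  intro a ℓ L
  by_cases h3 : 3 * ℓ ≤ L
  · exact hN' K hK hK' h3
  · refine ⟨1, one_pos, fun Ψ _ x₀ hx₀ => ?_⟩
    exact absurd (by linarith [(hx₀ 0).1, (hx₀ 0).2]) h3

/-- **Degenerate branch (`a = 0`, or formally `a = ⊤`): the body of `CellCountTails` for `v` holds
vacuously.** If `(scatteringLength v).toReal = 0` then `ℓ = K · (ρ · 0)^(-1/2) = 0`
(`Real.zero_rpow`), so `ρℓ³ = 0` and no window parameter `M` satisfies `1 ≤ M`, `M² ≤ ρℓ³`;
witnesses `K₀ = 0`, `ρ₀ = 1`, `C = c₁ = 1`, `δ = 1`. In particular the free gas (`v(|·|) = 0` a.e.,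
`a = 0`) is not a counterexample to the item AS TYPED, although its Dirichlet ground state
`∏ (2/L)^{3/2} ∏ₖ sin(πxₖ/L)` has inhomogeneous density and cell counts far from `ρℓ³`. [folklore] -/
theorem cellCountTails_body_of_toReal_scatteringLength_eq_zero (v : ℝ → ℝ≥0∞)
    (ha : (scatteringLength v).toReal = 0) :
    ∃ K₀ ρ₀ : ℝ, 0 < ρ₀ ∧ ∀ ρ : ℝ, 0 < ρ → ρ < ρ₀ → ∃ C c₁ : ℝ, 0 < c₁ ∧ ∀ K : ℝ, K₀ ≤ K →
      ∀ᶠ N : ℕ in Filter.atTop,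
        let a : ℝ := (scatteringLength v).toReal
        let ℓ : ℝ := K * (ρ * a) ^ (-(1 / 2 : ℝ))
        let L : ℝ := sideLength ρ N
        ∃ δ : ENNReal, 0 < δ ∧ ∀ Ψ : TrialState N L, energy v Ψ ≤ groundStateEnergy v N L + δ →
          ∀ x₀ : EuclideanSpace ℝ (Fin 3), (∀ k, ℓ ≤ x₀ k ∧ x₀ k + 2 * ℓ ≤ L) →
            ∀ M : ℝ, 1 ≤ M → M ^ 2 ≤ ρ * ℓ ^ 3 →
              ∫⁻ X in {X : Config N | M * Real.sqrt (ρ * ℓ ^ 3) <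
                  |(∑ j : Fin N, ({x : EuclideanSpace ℝ (Fin 3) |
                      ∀ k, x k ∈ Set.Ico (x₀ k) (x₀ k + ℓ)}).indicator (fun _ => (1 : ℝ)) (X j)) -
                    ρ * ℓ ^ 3|},
                (‖Ψ.ψ X‖₊ : ENNReal) ^ 2 ≤ ENNReal.ofReal (C * Real.exp (-(c₁ * M ^ 2))) := by
  refine ⟨0, 1, one_pos, fun ρ _ _ => ⟨1, 1, one_pos, fun K _ => Eventually.of_forall fun N => ?_⟩⟩
  intro a ℓ L
  refine ⟨1, one_pos, fun Ψ _ x₀ _ M hM hM2 => ?_⟩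
  exfalso
  have hℓ : ℓ = 0 := by
    show K * (ρ * (scatteringLength v).toReal) ^ (-(1 / 2 : ℝ)) = 0
    rw [ha, mul_zero, Real.zero_rpow (by norm_num), mul_zero]
  rw [hℓ] at hM2
  nlinarith

/-- **Normal form: WLOG the potential genuinely interacts.** `CellCountTails` is equivalent to its
restriction to potentials with `scatteringLength v ≠ ⊤` (automatic for finite range, LSSY App. C
Remark 2, `scatteringLength_ne_top_of_finiteRange`) and `0 < scatteringLength v` (else the body is
vacuous, `cellCountTails_body_of_toReal_scatteringLength_eq_zero`). So a proof may assume
`0 < a < ∞` — the dilute interacting gas, where the content is sub-Gaussian concentration of the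
interior cell count `N_Q` under near-ground states, uniformly in the cell size — and a refutation
must exhibit such a `v`. [folklore] -/
theorem cellCountTails_iff_pos_scatteringLength :
    CellCountTails ↔
      ∀ v : ℝ → ℝ≥0∞, IsRepulsiveFiniteRange v → scatteringLength v ≠ ⊤ → 0 < scatteringLength v →
        ∃ K₀ ρ₀ : ℝ, 0 < ρ₀ ∧ ∀ ρ : ℝ, 0 < ρ → ρ < ρ₀ → ∃ C c₁ : ℝ, 0 < c₁ ∧ ∀ K : ℝ, K₀ ≤ K →
          ∀ᶠ N : ℕ in Filter.atTop,
            let a : ℝ := (scatteringLength v).toReal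
            let ℓ : ℝ := K * (ρ * a) ^ (-(1 / 2 : ℝ))
            let L : ℝ := sideLength ρ N
            ∃ δ : ENNReal, 0 < δ ∧ ∀ Ψ : TrialState N L,
              energy v Ψ ≤ groundStateEnergy v N L + δ →
              ∀ x₀ : EuclideanSpace ℝ (Fin 3), (∀ k, ℓ ≤ x₀ k ∧ x₀ k + 2 * ℓ ≤ L) →
                ∀ M : ℝ, 1 ≤ M → M ^ 2 ≤ ρ * ℓ ^ 3 →
                  ∫⁻ X in {X : Config N | M * Real.sqrt (ρ * ℓ ^ 3) <
                      |(∑ j : Fin N, ({x : EuclideanSpace ℝ (Fin 3) |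
                          ∀ k, x k ∈ Set.Ico (x₀ k) (x₀ k + ℓ)}).indicator (fun _ => (1 : ℝ))
                            (X j)) - ρ * ℓ ^ 3|},
                    (‖Ψ.ψ X‖₊ : ENNReal) ^ 2 ≤
                      ENNReal.ofReal (C * Real.exp (-(c₁ * M ^ 2))) := by
  refine ⟨fun h v hv _ _ => h v hv, fun h v hv => ?_⟩
  obtain ⟨R₀, hR₀⟩ := hv.2
  have htop : scatteringLength v ≠ ⊤ := scatteringLength_ne_top_of_finiteRange hR₀
  rcases eq_or_ne (scatteringLength v) 0 with h0 | h0
  · exact cellCountTails_body_of_toReal_scatteringLength_eq_zero v (by rw [h0, ENNReal.toReal_zero])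
  · exact h v hv htop (pos_iff_ne_zero.mpr h0)

/-! ### Radial null sets; the free-gas branch in the route's a.e. phrasing (appended) -/

section FreeBranch

open MeasureTheory.Measure Metric Set

section Radial

variable {E : Type*} [NormedAddCommGroup E] [NormedSpace ℝ E] [MeasurableSpace E] [BorelSpace E]
  [FiniteDimensional ℝ E] (μ : Measure E) [μ.IsAddHaarMeasure]

/-- **Polar-coordinate formula for radial shells.** For a measurable `T ⊆ (0,∞)` the Haar measure of
the shell `{x | ‖x‖ ∈ T}` is `σ(S^{d-1}) · ∫_T r^{d-1} dr`, where `σ = μ.toSphere` and `d = dim E`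
(Mathlib's `measurePreserving_homeomorphUnitSphereProd`, sliced along the radial factor). [folklore] -/
theorem measure_preimage_norm {T : Set ℝ} (hT : MeasurableSet T) (hT0 : T ⊆ Ioi 0) :
    μ ((fun x : E => ‖x‖) ⁻¹' T) =
      μ.toSphere univ * ∫⁻ r in T, ENNReal.ofReal (r ^ (Module.finrank ℝ E - 1)) := by
  set e := homeomorphUnitSphereProd E with he
  have hpres := μ.measurePreserving_homeomorphUnitSphereProd
  set A : Set E := (fun x : E => ‖x‖) ⁻¹' T with hA_def
  have h0 : (0 : E) ∉ A := fun h => lt_irrefl (0 : ℝ) (by simpa [hA_def] using hT0 h)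
  set A' : Set ({(0 : E)}ᶜ : Set E) := Subtype.val ⁻¹' A with hA'_def
  have h1 : μ A = μ.comap Subtype.val A' := by
    rw [comap_subtype_coe_apply (measurableSet_singleton (0 : E)).compl, hA'_def,
      Subtype.image_preimage_coe, Set.inter_eq_right.2]
    intro x hx
    rw [Set.mem_compl_iff, Set.mem_singleton_iff]
    rintro rfl
    exact h0 hx
  set s : Set (sphere (0 : E) 1 × Ioi (0 : ℝ)) := univ ×ˢ (Subtype.val ⁻¹' T) with hs_def
  have hs : MeasurableSet s := MeasurableSet.univ.prod (measurable_subtype_coe hT)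
  have h2 : A' = e ⁻¹' s := by
    ext x
    simp [hA'_def, hA_def, hs_def, he]
  have h3 : volumeIoiPow (Module.finrank ℝ E - 1) (Subtype.val ⁻¹' T) =
      ∫⁻ r in T, ENNReal.ofReal (r ^ (Module.finrank ℝ E - 1)) := by
    rw [volumeIoiPow, withDensity_apply _ (measurable_subtype_coe hT),
      setLIntegral_subtype measurableSet_Ioi _
        (fun a : ℝ => ENNReal.ofReal (a ^ (Module.finrank ℝ E - 1))),
      Subtype.image_preimage_coe, Set.inter_eq_right.2 hT0]
  rw [h1, h2, hpres.measure_preimage hs.nullMeasurableSet, hs_def, Measure.prod_prod, h3]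

variable [Nontrivial E]

/-- **A radial function that vanishes a.e. on `(0,∞)` vanishes a.e. on `E`** (polar coordinates:
the shell over a Lebesgue-null set of radii is Haar-null; the origin is null). [folklore] -/
theorem ae_comp_norm_of_ae_restrict_Ioi {β : Type*} {f : ℝ → β} {b : β}
    (h : ∀ᵐ r ∂(volume.restrict (Ioi (0 : ℝ))), f r = b) : ∀ᵐ x ∂μ, f ‖x‖ = b := by
  rw [ae_restrict_iff' measurableSet_Ioi, ae_iff] at h
  obtain ⟨T, hTsub, hTm, hT0⟩ := exists_measurable_superset_of_null h
  have hshell : μ ((fun x : E => ‖x‖) ⁻¹' (T ∩ Ioi 0)) = 0 := by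
    rw [measure_preimage_norm μ (hTm.inter measurableSet_Ioi) Set.inter_subset_right,
      setLIntegral_measure_zero _ _ (measure_mono_null Set.inter_subset_left hT0), mul_zero]
  rw [ae_iff]
  refine measure_mono_null (fun x hx => ?_) (measure_union_null hshell (measure_singleton (0 : E)))
  by_cases hx0 : x = 0
  · exact Or.inr hx0
  · have hpos : ‖x‖ ∈ Ioi (0 : ℝ) := norm_pos_iff.2 hx0
    have hmem : ‖x‖ ∈ {r : ℝ | ¬(r ∈ Ioi (0 : ℝ) → f r = b)} := fun himp => hx (himp hpos)
    exact Or.inl ⟨hTsub hmem, hpos⟩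

/-- **Conversely, a radial function that vanishes a.e. on `E` vanishes a.e. on `(0,∞)`**
(`E` nontrivial: the sphere measure is nonzero and `r^{d-1} > 0` on `(0,∞)`). [folklore] -/
theorem ae_restrict_Ioi_of_ae_comp_norm {β : Type*} {f : ℝ → β} {b : β}
    (hf : MeasurableSet {r | f r = b}) (h : ∀ᵐ x ∂μ, f ‖x‖ = b) :
    ∀ᵐ r ∂(volume.restrict (Ioi (0 : ℝ))), f r = b := by
  rw [ae_restrict_iff' measurableSet_Ioi, ae_iff]
  set T : Set ℝ := {r | ¬(r ∈ Ioi (0 : ℝ) → f r = b)} with hT_def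
  have hT : T = Ioi 0 ∩ {r | f r = b}ᶜ := by
    ext r; simp [hT_def]
  have hTm : MeasurableSet T := by rw [hT]; exact measurableSet_Ioi.inter hf.compl
  have hT0 : T ⊆ Ioi 0 := by rw [hT]; exact Set.inter_subset_left
  have hshell : μ ((fun x : E => ‖x‖) ⁻¹' T) = 0 := by
    rw [ae_iff] at h
    refine measure_mono_null (fun x hx => ?_) h
    have hx' : ‖x‖ ∈ T := hx
    rw [hT] at hx'
    exact hx'.2
  rw [measure_preimage_norm μ hTm hT0] at hshell
  have hsph : μ.toSphere univ ≠ 0 := by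
    rw [Ne, measure_univ_eq_zero]; exact μ.toSphere_ne_zero
  have hint : ∫⁻ r in T, ENNReal.ofReal (r ^ (Module.finrank ℝ E - 1)) = 0 :=
    (mul_eq_zero.1 hshell).resolve_left hsph
  have hae : ∀ᵐ r ∂(volume.restrict T), ENNReal.ofReal (r ^ (Module.finrank ℝ E - 1)) = 0 :=
    (lintegral_eq_zero_iff (by fun_prop)).1 hint
  rw [ae_restrict_iff' hTm, ae_iff] at hae
  refine measure_mono_null (fun r hr => ?_) hae
  simp only [Set.mem_setOf_eq, Classical.not_imp]
  exact ⟨hr, by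
    rw [ENNReal.ofReal_eq_zero, not_le]
    exact pow_pos (hT0 hr) _⟩

end Radial

/-- **Free branch of the scattering length.** If `v = 0` a.e. on `(0,∞)` then `v(|x|) = 0` for
a.e. `x ∈ ℝ³` and the scattering length vanishes: `4πa ≤ ½∫ v(|x|) dx = 0`
(Spruch–Rosenberg, `four_pi_mul_scatteringLength_le`). Converse of the tree's
`LSSY2005_zeroScatteringLength_holds` up to the radial/spatial a.e. bridge above. [cite: LSSY2005, App. C (C.10)] -/
theorem scatteringLength_eq_zero_of_ae_restrict_Ioi {v : ℝ → ℝ≥0∞}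
    (h : ∀ᵐ r ∂(volume.restrict (Ioi (0 : ℝ))), v r = 0) : scatteringLength v = 0 := by
  have hae : ∀ᵐ x : Space, v ‖x‖ = 0 := ae_comp_norm_of_ae_restrict_Ioi volume h
  have hint : (∫⁻ x : Space, 2⁻¹ * v ‖x‖) = 0 := by
    rw [lintegral_congr_ae (hae.mono fun x hx => by rw [hx, mul_zero]), lintegral_zero]
  have h4 := four_pi_mul_scatteringLength_le v
  rw [hint, nonpos_iff_eq_zero, mul_eq_zero] at h4
  exact h4.resolve_left (ENNReal.ofReal_ne_zero_iff.mpr (by positivity))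

/-- **The free-gas branch of `CellCountTails` is vacuous.** For a (repulsive, finite-range or not)
potential that vanishes a.e. on `(0,∞)` — the hypothesis of the route's `FreeGasZeroMode` — the
scattering length is `0`, so the body of `CellCountTails` holds for `v` by
`cellCountTails_body_of_toReal_scatteringLength_eq_zero`. [folklore] -/
theorem cellCountTails_body_of_ae_restrict_Ioi (v : ℝ → ℝ≥0∞)
    (h : ∀ᵐ r ∂(volume.restrict (Ioi (0 : ℝ))), v r = 0) :
    ∃ K₀ ρ₀ : ℝ, 0 < ρ₀ ∧ ∀ ρ : ℝ, 0 < ρ → ρ < ρ₀ → ∃ C c₁ : ℝ, 0 < c₁ ∧ ∀ K : ℝ, K₀ ≤ K →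
      ∀ᶠ N : ℕ in Filter.atTop,
        let a : ℝ := (scatteringLength v).toReal
        let ℓ : ℝ := K * (ρ * a) ^ (-(1 / 2 : ℝ))
        let L : ℝ := sideLength ρ N
        ∃ δ : ENNReal, 0 < δ ∧ ∀ Ψ : TrialState N L, energy v Ψ ≤ groundStateEnergy v N L + δ →
          ∀ x₀ : EuclideanSpace ℝ (Fin 3), (∀ k, ℓ ≤ x₀ k ∧ x₀ k + 2 * ℓ ≤ L) →
            ∀ M : ℝ, 1 ≤ M → M ^ 2 ≤ ρ * ℓ ^ 3 →
              ∫⁻ X in {X : Config N | M * Real.sqrt (ρ * ℓ ^ 3) <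
                  |(∑ j : Fin N, ({x : EuclideanSpace ℝ (Fin 3) |
                      ∀ k, x k ∈ Set.Ico (x₀ k) (x₀ k + ℓ)}).indicator (fun _ => (1 : ℝ)) (X j)) -
                    ρ * ℓ ^ 3|},
                (‖Ψ.ψ X‖₊ : ENNReal) ^ 2 ≤ ENNReal.ofReal (C * Real.exp (-(c₁ * M ^ 2))) :=
  cellCountTails_body_of_toReal_scatteringLength_eq_zero v
    (by rw [scatteringLength_eq_zero_of_ae_restrict_Ioi h, ENNReal.toReal_zero])

/-- **`a = 0` iff free, for the standing class.** For a repulsive finite-range `v`: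
`scatteringLength v = 0 ↔ v = 0` a.e. on `(0,∞)` (`⇐` above; `⇒` is the tree's
`LSSY2005_zeroScatteringLength_holds` followed by the spatial-to-radial a.e. bridge
`ae_restrict_Ioi_of_ae_comp_norm`). In particular the second clause of the route's support item
`ScatteringLengthPos` is the contrapositive of `→`. [cite: LSSY2005, App. C Thm. C.1 (C.8), (C.10)] -/
theorem scatteringLength_eq_zero_iff_ae_restrict_Ioi {v : ℝ → ℝ≥0∞} (hv : IsRepulsiveFiniteRange v) :
    scatteringLength v = 0 ↔ ∀ᵐ r ∂(volume.restrict (Ioi (0 : ℝ))), v r = 0 := by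
  refine ⟨fun h0 => ?_, scatteringLength_eq_zero_of_ae_restrict_Ioi⟩
  obtain ⟨hvm, R₀, hR₀⟩ := hv
  have hae : ∀ᵐ x : Space, v ‖x‖ = 0 := LSSY2005_zeroScatteringLength_holds v R₀ hvm hR₀ h0
  exact ae_restrict_Ioi_of_ae_comp_norm volume (hvm (measurableSet_singleton 0)) hae


end FreeBranch

end Summit.AtomisticToContinuum.BoseEinsteinCondensation.Theorems

end
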